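import Mathlib.FieldTheory.Finite.Basic
import Literature.NumberTheory.GaloisCohomology.PBasisForms
import Literature.NumberTheory.GaloisCohomology.DeRhamWeights
import HarnessLib

/-!
# The Koszul contraction and the Cartier projector: definitions and matrix entries

Let `R` be a ring of characteristic `p` with a finite `p`-basis `t : ι → R` (`ι` linearly ordered), and let
`E (α, s) = t^α • dt_s` be the twisted monomial basis of `Ωⁿ_R` (`PBasisForms.lean`: `IsPBasis.twistFormBasis`;
`d` has an integer matrix on it, `dTwist_twistFormBasis`).  The exterior derivative preserves the WEIGHT
`wt α s` (`DeRhamWeights.lean`), and on the vectors of a given weight with live set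
`live α s = {i | 0 < wt α s i < p} ≠ ∅` it is a Koszul complex on units of `𝔽_p`.  This file DEFINES the
classical **contracting homotopy** `h` ("divide by the weight at `i₀ = min live` and remove `dt_{i₀}`",
`IsPBasis.hTwist`, matrix `hVec`) and the **projector** `π` onto the Cartier vectors (`live = ∅`, i.e.
`t_s^{p-1} dt_s`; `IsPBasis.πTwist`, matrix `πVec`), both `R`-linear for the twisted structures with integer
matrices, together with the arithmetic of the coefficients (`invWt`: `w⁻¹ := w^{p-2}` acting through `ℤ`,
`zsmul_eq_self_of_modEq_one`), the sign identity `insertSign_bracket` behind the cancellation in `dh + hd`, and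
the index-set bookkeeping `eraseIdx`.  Matrix entries: `h (E (α, s)) = (w⁻¹ ε) • E (α + e_{i₀}, s ∖ i₀)` when
`i₀ ∈ s` (`w = wt α s i₀`, `ε = insertSign (s ∖ i₀) i₀`), and `0` otherwise; `π (E (α, s)) = E (α, s)` if
`live α s = ∅`, else `0`.  The homotopy identity `d ∘ h + h ∘ d = 1 - π` is proved in
`PBasisKoszulHomotopy.lean`.

## References

* L. Illusie, *Complexe de de Rham–Witt et cohomologie cristalline*, Ann. Sci. ÉNS 12 (1979), 0.2
  (Cartier isomorphism via the grading of the de Rham complex of a polynomial algebra). [Illusie1979]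
* N. Katz, *Nilpotent connections and the monodromy theorem*, Publ. IHÉS 39 (1970), Thm. 7.2. [folklore]
-/

noncomputable section

open scoped BigOperators
open KaehlerDifferential (D)
open Literature.AlgebraicGeometry.Crystalline (insertSign coe_insertSign insertSign_mul_self
  insertSign_insert_of_lt insertSign_insert_of_lt_of_notMem)

namespace Literature.NumberTheory.GaloisCohomology

universe u v

/-! ### Arithmetic: inverting a weight through the integers -/

section Arith

variable (p : ℕ) [hp : Fact p.Prime]

/-- The integer `w^{p-2}`, an inverse of `w` modulo `p` for `0 < w < p`. [folklore] -/
def invWt (w : ℕ) : ℤ := ((w ^ (p - 2) : ℕ) : ℤ)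

/-- `w^{p-2} · w ≡ 1 (mod p)` for `0 < w < p` (Fermat). [folklore] -/
theorem invWt_mul_modEq {w : ℕ} (hw : 0 < w) (hwp : w < p) : invWt p w * w ≡ 1 [ZMOD p] := by
  rw [← ZMod.intCast_eq_intCast_iff, invWt]
  push_cast
  have hw0 : (w : ZMod p) ≠ 0 := by
    rw [Ne, ZMod.natCast_eq_zero_iff]
    exact Nat.not_dvd_of_pos_of_lt hw hwp
  have h2 : p - 2 + 1 = p - 1 := by have := hp.out.two_le; omega
  rw [← pow_succ, h2, ZMod.pow_card_sub_one_eq_one hw0]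

variable {p} {R : Type u} [CommRing R] [CharP R p]

omit hp in
/-- In a module over a ring of characteristic `p`, an integer `≡ 1 (mod p)` acts as the identity. [folklore] -/
theorem zsmul_eq_self_of_modEq_one {M : Type*} [AddCommGroup M] [Module R M] {m : ℤ} (hm : m ≡ 1 [ZMOD p])
    (x : M) : m • x = x := by
  rw [← Int.cast_smul_eq_zsmul R, (CharP.intCast_eq_intCast R p).2 hm, Int.cast_one, one_smul]

end Arith

/-! ### A sign identity -/

section Sign

variable {ι : Type v} [LinearOrder ι]

/-- **The cancellation of signs in `dh + hd`**: for distinct `i₀, i ∉ s'`,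
`ε(s', i₀) ε(s', i) + ε(insert i₀ s', i) ε(insert i s', i₀) = 0`. [folklore] -/
theorem insertSign_bracket (s' : Finset ι) {i₀ i : ι} (hi₀ : i₀ ∉ s') (hi : i ∉ s') (hne : i₀ ≠ i) :
    ((insertSign s' i₀ : ℤˣ) : ℤ) * insertSign s' i +
      (insertSign (insert i₀ s') i : ℤˣ) * (insertSign (insert i s') i₀ : ℤˣ) = 0 := by
  rcases lt_or_gt_of_ne hne with h | h
  · rw [insertSign_insert_of_lt_of_notMem s' h hi₀, insertSign_insert_of_lt s' h, Units.val_neg]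
    ring
  · rw [insertSign_insert_of_lt s' h, insertSign_insert_of_lt_of_notMem s' h hi, Units.val_neg]
    ring

/-- `ε · ε = 1` in `ℤ`. [folklore] -/
theorem coe_insertSign_mul_self (s : Finset ι) (i : ι) :
    ((insertSign s i : ℤˣ) : ℤ) * (insertSign s i : ℤˣ) = 1 := by
  rw [← Units.val_mul, insertSign_mul_self, Units.val_one]

end Sign

namespace IsPBasis

open DeRhamWeights

variable {p : ℕ} [hp : Fact p.Prime] {R : Type u} [CommRing R] [CharP R p] {ι : Type v} [Fintype ι]
  [LinearOrder ι] {t : ι → R}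

/-! ### Index sets of the h-move -/

omit hp [CharP R p] [Fintype ι] in
/-- The `n`-element index set `s.erase i` of an h-move (`i ∈ s`). [folklore] -/
def eraseIdx {n : ℕ} (s : Set.powersetCard ι (n + 1)) (i : ι) (hi : i ∈ (s : Finset ι)) :
    Set.powersetCard ι n :=
  ⟨(s : Finset ι).erase i, Set.powersetCard.mem_iff.mpr
    (by rw [Finset.card_erase_of_mem hi, Set.powersetCard.card_eq]; rfl)⟩

omit hp [CharP R p] [Fintype ι] in
/-- The underlying finset of `eraseIdx s i hi` is `s.erase i`. [folklore] -/
@[simp] theorem coe_eraseIdx {n : ℕ} (s : Set.powersetCard ι (n + 1)) (i : ι) (hi : i ∈ (s : Finset ι)) :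
    ((eraseIdx s i hi : Set.powersetCard ι n) : Finset ι) = (s : Finset ι).erase i :=
  rfl

omit hp [CharP R p] [Fintype ι] in
/-- Insert after erase: `insertIdx (eraseIdx s i) i = s`. [folklore] -/
theorem insertIdx_eraseIdx {n : ℕ} (s : Set.powersetCard ι (n + 1)) (i : ι) (hi : i ∈ (s : Finset ι))
    (hi' : i ∉ ((eraseIdx s i hi : Set.powersetCard ι n) : Finset ι)) :
    insertIdx (eraseIdx s i hi) i hi' = s :=
  Subtype.ext (Finset.insert_erase hi)

omit hp [CharP R p] [Fintype ι] in
/-- Erase after insert: `eraseIdx (insertIdx s i) i = s`. [folklore] -/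
theorem eraseIdx_insertIdx {n : ℕ} (s : Set.powersetCard ι n) (i : ι) (hi : i ∉ (s : Finset ι))
    (hi' : i ∈ ((insertIdx s i hi : Set.powersetCard ι (n + 1)) : Finset ι)) :
    eraseIdx (insertIdx s i hi) i hi' = s :=
  Subtype.ext (Finset.erase_insert hi)

omit hp [CharP R p] [Fintype ι] in
/-- The two moves commute on index sets: `(insert i s).erase i₀ = insert i (s.erase i₀)` (`i ≠ i₀`). [folklore] -/
theorem eraseIdx_insertIdx_of_ne {n : ℕ} (s : Set.powersetCard ι (n + 1)) {i i₀ : ι} (hne : i ≠ i₀)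
    (hi : i ∉ (s : Finset ι)) (hi₀' : i₀ ∈ ((insertIdx s i hi : Set.powersetCard ι (n + 2)) : Finset ι))
    (hi₀ : i₀ ∈ (s : Finset ι)) (hi' : i ∉ ((eraseIdx s i₀ hi₀ : Set.powersetCard ι n) : Finset ι)) :
    eraseIdx (insertIdx s i hi) i₀ hi₀' = insertIdx (eraseIdx s i₀ hi₀) i hi' :=
  Subtype.ext (Finset.erase_insert_of_ne hne)

/-! ### The contraction `h` and the projector `π` -/

/-- **Matrix of the Koszul contraction** on a monomial vector `E (α, s)` of degree `n + 1`:
`(w⁻¹ ε) • E (α + e_{i₀}, s ∖ i₀)` if the live set is nonempty with minimum `i₀ ∈ s` (`w = wt α s i₀`,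
`ε = insertSign (s ∖ i₀) i₀`), and `0` otherwise. [cite: Illusie1979, 0.2] -/
def hVec (h : IsPBasis p t) (n : ℕ) (αs : (ι → Fin p) × Set.powersetCard ι (n + 1)) :
    FrobeniusTwist p R (⋀[R]^n (Ω[R⁄ℤ])) :=
  if hl : (live αs.1 (αs.2 : Finset ι)).Nonempty then
    if hi : (live αs.1 (αs.2 : Finset ι)).min' hl ∈ (αs.2 : Finset ι) then
      (invWt p (wt αs.1 (αs.2 : Finset ι) ((live αs.1 (αs.2 : Finset ι)).min' hl)) *
          (insertSign ((αs.2 : Finset ι).erase ((live αs.1 (αs.2 : Finset ι)).min' hl))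
            ((live αs.1 (αs.2 : Finset ι)).min' hl) : ℤˣ)) •
        h.twistFormBasis n (αs.1 + Pi.single ((live αs.1 (αs.2 : Finset ι)).min' hl) 1,
          eraseIdx αs.2 _ hi)
    else 0
  else 0

/-- **The Koszul contraction** `h : Ωⁿ⁺¹ → Ωⁿ` (twisted-`R`-linear, integer matrix `hVec`). [cite: Illusie1979, 0.2] -/
def hTwist (h : IsPBasis p t) (n : ℕ) :
    FrobeniusTwist p R (⋀[R]^(n + 1) (Ω[R⁄ℤ])) →ₗ[R] FrobeniusTwist p R (⋀[R]^n (Ω[R⁄ℤ])) :=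
  (h.twistFormBasis (n + 1)).constr ℤ (h.hVec n)

/-- `h` on basis vectors. [folklore] -/
theorem hTwist_basis (h : IsPBasis p t) (n : ℕ) (αs : (ι → Fin p) × Set.powersetCard ι (n + 1)) :
    h.hTwist n (h.twistFormBasis (n + 1) αs) = h.hVec n αs :=
  Module.Basis.constr_basis _ _ _ _

/-- **Matrix of the projector** onto Cartier vectors: `E (α, s)` if `live α s = ∅`, else `0`. [cite: Illusie1979, 0.2] -/
def πVec (h : IsPBasis p t) (n : ℕ) (αs : (ι → Fin p) × Set.powersetCard ι n) :
    FrobeniusTwist p R (⋀[R]^n (Ω[R⁄ℤ])) :=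
  if live αs.1 (αs.2 : Finset ι) = ∅ then h.twistFormBasis n αs else 0

/-- **The projector `π` onto the Cartier vectors** `t_s^{p-1} dt_s` (twisted-`R`-linear). [cite: Illusie1979, 0.2] -/
def πTwist (h : IsPBasis p t) (n : ℕ) :
    FrobeniusTwist p R (⋀[R]^n (Ω[R⁄ℤ])) →ₗ[R] FrobeniusTwist p R (⋀[R]^n (Ω[R⁄ℤ])) :=
  (h.twistFormBasis n).constr ℤ (h.πVec n)

/-- `π` on basis vectors. [folklore] -/
theorem πTwist_basis (h : IsPBasis p t) (n : ℕ) (αs : (ι → Fin p) × Set.powersetCard ι n) :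
    h.πTwist n (h.twistFormBasis n αs) = h.πVec n αs :=
  Module.Basis.constr_basis _ _ _ _

/-- `π` on a basis vector with a live index is `0`. [folklore] -/
theorem πVec_of_live_nonempty (h : IsPBasis p t) (n : ℕ) {α : ι → Fin p} {s : Set.powersetCard ι n}
    (hl : (live α (s : Finset ι)).Nonempty) : h.πVec n (α, s) = 0 := by
  rw [πVec, if_neg (Finset.nonempty_iff_ne_empty.1 hl)]

/-- `π` on a Cartier vector (no live index) is the identity. [folklore] -/
theorem πVec_of_live_eq_empty (h : IsPBasis p t) (n : ℕ) {α : ι → Fin p} {s : Set.powersetCard ι n}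
    (hl : live α (s : Finset ι) = ∅) : h.πVec n (α, s) = h.twistFormBasis n (α, s) := by
  rw [πVec, if_pos hl]

/-! ### Values of `hVec` -/

/-- `hVec` vanishes when there is no live index. [folklore] -/
theorem hVec_of_live_eq_empty (h : IsPBasis p t) (n : ℕ) {α : ι → Fin p} {s : Set.powersetCard ι (n + 1)}
    (hl : live α (s : Finset ι) = ∅) : h.hVec n (α, s) = 0 := by
  rw [hVec, dif_neg (Finset.not_nonempty_iff_eq_empty.2 hl)]

/-- `hVec` vanishes when the minimal live index is not in `s`. [folklore] -/
theorem hVec_of_min_not_mem (h : IsPBasis p t) (n : ℕ) {α : ι → Fin p} {s : Set.powersetCard ι (n + 1)}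
    (hl : (live α (s : Finset ι)).Nonempty) {i₀ : ι} (hmin : (live α (s : Finset ι)).min' hl = i₀)
    (hi₀ : i₀ ∉ (s : Finset ι)) : h.hVec n (α, s) = 0 := by
  subst hmin
  rw [hVec, dif_pos hl, dif_neg hi₀]

/-- **`hVec` when the minimal live index `i₀` lies in `s`**: `(w⁻¹ ε) • E (α + e_{i₀}, s ∖ i₀)`. [folklore] -/
theorem hVec_of_min_mem (h : IsPBasis p t) (n : ℕ) {α : ι → Fin p} {s : Set.powersetCard ι (n + 1)}
    (hl : (live α (s : Finset ι)).Nonempty) {i₀ : ι} (hmin : (live α (s : Finset ι)).min' hl = i₀)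
    (hi₀ : i₀ ∈ (s : Finset ι)) :
    h.hVec n (α, s) = (invWt p (wt α (s : Finset ι) i₀) * (insertSign ((s : Finset ι).erase i₀) i₀ : ℤˣ)) •
      h.twistFormBasis n (α + Pi.single i₀ 1, eraseIdx s i₀ hi₀) := by
  subst hmin
  rw [hVec, dif_pos hl, dif_pos hi₀]

/-! ### Transport of `live`, `min'` and `wt` along the two moves -/

omit hp [CharP R p] [Fintype ι] in
/-- `min'` of equal finsets (with possibly different nonemptiness proofs). [folklore] -/
theorem min'_eq_of_eq {a b : Finset ι} (hab : a = b) (ha : a.Nonempty) (hb : b.Nonempty) :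
    a.min' ha = b.min' hb := by
  subst hab
  rfl

end IsPBasis

end Literature.NumberTheory.GaloisCohomology

end
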